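import Summits.HodgeConjecture.HodgeConjecture.Theorems.Ring2HypothesesDescentMotivatedTraceFormulaPairing
import Summits.HodgeConjecture.HodgeConjecture.Theorems.Ring2HypothesesDescentMotivatedKunneth
import Summits.HodgeConjecture.HodgeConjecture.Theorems.Ring2AbelianAllStandardBProducts
import Summits.HodgeConjecture.HodgeConjecture.Theorems.Ring2AbelianAllStandardAPencils
import Summits.HodgeConjecture.HodgeConjecture.Theorems.Ring2AbelianAllAndreStandardANumerical
import Literature.AlgebraicGeometry.HodgeTheory.AlgebraicClassesPullback
import Mathlib.RingTheory.Artinian.Module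
import HarnessLib

/-!
# Ring 2 hypotheses, descent face — JANNSEN'S LEMMA AND KLEIMAN'S «`B(X) ⟹` THE ALGEBRA OF ALGEBRAIC CORRESPONDENCES
# IS SEMISIMPLE» on the real carriers: nil ideals of algebraic endo-correspondence operators are numerically trivial
# (unconditionally), hence zero under `B(X)`, and then the operator algebra on each `Hᵃ(X(ℂ); ℂ)` is semisimple

research route conditional on HC_CM; not a corollary; Q11.4-sentence-2 already refuted in dim ≥ 3.
Cell `pub-hodge-ring2` (Hodge ladder STAGE 3), seat `ring2-b05` (binder row b05
`Ring2.Hypotheses.MotivatedImpliesAlgebraicAV`; parent node `MotivatedImpliesAlgebraic ⟺` binder b10 `B(all)`), gen 37.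
`HC_CM` (`Theses.RankFourFaces.CMAbelianHodge`) does not occur in this file; nothing here proves a case of the Hodge
conjecture or of `B(X)`: every `B` below is a displayed HYPOTHESIS (`StandardConjectureBStar`); the row b05 stays OPEN.

The companion `…MotivatedSemisimple` proves André's Prop. 3.1 / 3.3 for MOTIVATED correspondences unconditionally. The
same trace-formula argument (Jannsen 1992, Lemma 1; André Prop. 3.1 is «l'analogue pour les cycles motivés du théorème de
Jannsen») runs for ALGEBRAIC correspondences, `Aⁿ(X ⊗ X)_ℂ = algebraicClasses (X ⊗ X) n` (the `ℂ`-span of cycle classes):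

* §1 **JANNSEN'S LEMMA, unconditional**: `cupProduct_eq_zero_of_forall_trace_comp_algebraic_eq_zero` — a class
  `u ∈ H²ⁿ((X ⊗ X)(ℂ))` with `Tr([w]_* ∘ [u]_* | Hᵃ) = 0` for all algebraic `w` and all `a` is NUMERICALLY TRIVIAL
  (`u ∪ v = 0` for every `v ∈ Aⁿ(X ⊗ X)_ℂ`); `…_of_forall_isNilpotent_comp_algebraic` — in particular every element of
  a nil left ideal of algebraic correspondences is numerically trivial (the trace formula of `…TraceFormulaPairing`
  and `σ^* Aⁿ = Aⁿ`).
* §2 **Per degree, under `D(X ⊗ X)` in codimension `n` (hom ≡ num on `Aⁿ(X ⊗ X)_ℂ`, hypothesis `hD`) and an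
  ALGEBRAIC Künneth projector `πᵃ` (hypothesis `hπ`; Kleiman: `B(X) ⟹ C(X)`, the tree's
  `exists_algebraic_kunnethProjector_of_standardConjectureBStar`)**: `corrAction_eq_zero_of_forall_isNilpotent_comp_algebraic`
  — `[w]_* ∘ [u]_*` nilpotent on `Hᵃ` for all algebraic `w` forces `[u]_* = 0` on `Hᵃ`.
* §3 **KLEIMAN / JANNSEN: `B(X, η) ⟹` the `ℂ`-algebra of operators on `Hᵃ(X(ℂ); ℂ)` induced by `Aⁿ(X ⊗ X)_ℂ` is
  SEMISIMPLE** (`isSemisimpleRing_adjoin_algebraicOperators_of_standardConjectureBStar`, complex orientation family):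
  `B(X, η) ⟹ B(X ⊗ X, θ)` for all `θ` (ab-andre's `standardConjectureBStar_tensor`) `⟹ A(X ⊗ X, θ)`
  (`standardConjectureA_of_standardConjectureBStar`) `⟹ D` on `Aⁿ(X ⊗ X)_ℂ` over `ℂ` by Hodge–Riemann
  (`nondegenerate_algebraicClasses_of_standardConjectureA`), and `B(X, η) ⟹ C(X)`; then §2 kills the (nilpotent) Jacobson
  radical of the finite-dimensional operator algebra (`IsArtinianRing.isSemisimpleRing_iff_jacobson`). With
  `exists_isCompl_of_algebraicOperators_stable_of_standardConjectureBStar`: under `B(X, η)` every subspace of `Hᵃ(X(ℂ); ℂ)`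
  stable under all algebraic correspondences has a stable complement.

No definition, no named fact, no sorry; `B` is never asserted. References: Jannsen1992 (Motives, numerical equivalence,
and semi-simplicity, Invent. Math. 107 (1992) 447–452, Lemma 1, Thm. 1), Kleiman1968AlgebraicCycles (§1.3 Prop. 1.3.6,
§3 Prop. 3.5, Thm. 3.9–3.11), Andre1996Motifs (Prop. 3.1 p. 20), Grothendieck1968 (§3 p. 196).
-/

noncomputable section

-- every declaration of this problem lives in `Summit.HodgeConjecture.HodgeConjecture.…` (summit = sub-problem)
set_option linter.dupNamespace false

open CategoryTheory AlgebraicGeometry MonoidalCategory CartesianMonoidalCategory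
open Literature.AlgebraicTopology.SingularHomology Literature.Geometry.Kaehler
open Literature.AlgebraicGeometry Literature.AlgebraicGeometry.Motives
  Literature.AlgebraicGeometry.HodgeTheory

namespace Summit.HodgeConjecture.HodgeConjecture.Theorems

variable (μ : OrientationFamily) {n : ℕ} {X : SchemeOver ℂ}

/-! ## §1 Jannsen's lemma: trace-orthogonal (e.g. nil) algebraic correspondences are numerically trivial -/

/-- **JANNSEN'S LEMMA on the real carriers, unconditional.** For `X` smooth projective of dimension `n`, an orientation
family `μ` and ANY class `u ∈ H²ⁿ((X ⊗ X)(ℂ); ℂ)`: if `Tr([w]_* ∘ [u]_* | Hᵃ(X(ℂ))) = 0` for every algebraic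
`w ∈ Aⁿ(X ⊗ X)_ℂ` and every `a ≤ 2n`, then `u` is numerically trivial against `Aⁿ(X ⊗ X)_ℂ`: `u ∪ v = 0` for every
algebraic `v`. Trace formula `p₁₊ p₂^* p₁₊(u ∪ σ^* w) = (Σₐ (-1)ᵃ Tr) · 1 = 0` with `w = σ^* v` algebraic
(`map_mem_algebraicClasses_of_isIso`), `σ^* σ^* = id`, and injectivity of the reading (`eq_zero_of_fibreIntegral_fst_eq_zero`).
[cite: Jannsen1992, Lemma 1] [cite: Kleiman1968AlgebraicCycles, §1.3 Prop. 1.3.6] [cite: Andre1996Motifs, Prop. 3.1 (p. 20)] -/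
theorem cupProduct_eq_zero_of_forall_trace_comp_algebraic_eq_zero (hX : IsSmoothProjective n X)
    {u : complexBetti (X ⊗ X) (2 * n)}
    (h : ∀ w ∈ algebraicClasses (X ⊗ X) n, ∀ a ≤ 2 * n,
      LinearMap.trace ℂ _ (corrAction μ hX hX (rfl : a + 2 * n = a + 2 * n) w ∘ₗ
        corrAction μ hX hX (rfl : a + 2 * n = a + 2 * n) u) = 0) :
    ∀ v ∈ algebraicClasses (X ⊗ X) n, cupProduct (show 2 * n + 2 * n = 2 * (n + n) by omega) u v = 0 := by
  intro v hv
  have hσv : complexBetti.map (β_ X X).hom (2 * n) v ∈ algebraicClasses (X ⊗ X) n :=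
    map_mem_algebraicClasses_of_isIso (β_ X X).hom hv
  have hvv : v = complexBetti.map (β_ X X).hom (2 * n) (complexBetti.map (β_ X X).hom (2 * n) v) := by
    rw [← complexBetti.map_comp_apply', SymmetricCategory.symmetry, complexBetti.map_id]
    rfl
  rw [hvv]
  refine eq_zero_of_fibreIntegral_fst_eq_zero μ hX ?_
  rw [← gradedTrace_corrAction_comp_smul_one μ hX u, Finset.sum_eq_zero, zero_smul]
  intro a ha
  rw [h _ hσv a (by simpa [Nat.lt_succ_iff] using Finset.mem_range.mp ha), mul_zero]

/-- **Nil form of Jannsen's lemma**: if `[w]_* ∘ [u]_*` is nilpotent on every `Hᵃ(X(ℂ))` for every algebraic `w`, then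
`u` is numerically trivial against `Aⁿ(X ⊗ X)_ℂ` (nilpotent operators have trace `0`). In particular every element of a
nil left ideal of the algebra of algebraic correspondences is `≡_num 0`. [cite: Jannsen1992, Lemma 1]
[cite: Andre1996Motifs, Prop. 3.1 (p. 20)] -/
theorem cupProduct_eq_zero_of_forall_isNilpotent_comp_algebraic (hX : IsSmoothProjective n X)
    {u : complexBetti (X ⊗ X) (2 * n)}
    (h : ∀ w ∈ algebraicClasses (X ⊗ X) n, ∀ a ≤ 2 * n,
      IsNilpotent (corrAction μ hX hX (rfl : a + 2 * n = a + 2 * n) w ∘ₗ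
        corrAction μ hX hX (rfl : a + 2 * n = a + 2 * n) u)) :
    ∀ v ∈ algebraicClasses (X ⊗ X) n, cupProduct (show 2 * n + 2 * n = 2 * (n + n) by omega) u v = 0 :=
  cupProduct_eq_zero_of_forall_trace_comp_algebraic_eq_zero μ hX fun w hw a ha ↦
    (LinearMap.isNilpotent_trace_of_isNilpotent (h w hw a ha)).eq_zero

/-! ## §2 Under `D` on `Aⁿ(X ⊗ X)_ℂ` and an algebraic Künneth projector: nil ⟹ zero, per degree -/

/-- **Per degree, modulo hom ≡ num on `Aⁿ(X ⊗ X)_ℂ` (`hD`) and an algebraic Künneth projector `πᵃ` (`hπ`)**: for an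
algebraic `u ∈ Aⁿ(X ⊗ X)_ℂ`, if `Tr([w]_* ∘ [u]_* | Hᵃ) = 0` for every algebraic `w`, then `[u]_* = 0` on `Hᵃ(X(ℂ); ℂ)`.
The algebraic composite `u ∘ πᵃ` (`exists_corrCompClass_total`) acts as `[u]_*` on `Hᵃ` and `0` elsewhere, so all
its traces vanish, it is numerically trivial (§1), hence `0` by `hD`. [cite: Jannsen1992, Lemma 1]
[cite: Kleiman1968AlgebraicCycles, §1.4 Prop. 1.4.4 and §3 Prop. 3.5] -/
theorem corrAction_eq_zero_of_forall_trace_comp_algebraic_eq_zero (hX : IsSmoothProjective n X)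
    (hD : ∀ ξ ∈ algebraicClasses (X ⊗ X) n,
      (∀ v ∈ algebraicClasses (X ⊗ X) n, cupProduct (show 2 * n + 2 * n = 2 * (n + n) by omega) ξ v = 0) → ξ = 0)
    {a : ℕ} (hπ : ∃ π ∈ algebraicClasses (X ⊗ X) n, ∀ a' : ℕ,
      corrAction μ hX hX (rfl : a' + 2 * n = a' + 2 * n) π = if a' = a then LinearMap.id else 0)
    {u : complexBetti (X ⊗ X) (2 * n)} (hu : u ∈ algebraicClasses (X ⊗ X) n)
    (h : ∀ w ∈ algebraicClasses (X ⊗ X) n,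
      LinearMap.trace ℂ _ (corrAction μ hX hX (rfl : a + 2 * n = a + 2 * n) w ∘ₗ
        corrAction μ hX hX (rfl : a + 2 * n = a + 2 * n) u) = 0) :
    corrAction μ hX hX (rfl : a + 2 * n = a + 2 * n) u = 0 := by
  obtain ⟨π, hπalg, hπa⟩ := hπ
  obtain ⟨u', -, hu'alg, hact⟩ := exists_corrCompClass_total μ hX hX hX (e := n) (e' := n) (e'' := n) rfl u π
  have hu' : u' ∈ algebraicClasses (X ⊗ X) n := hu'alg hu hπalg
  have hact' : ∀ a' : ℕ, corrAction μ hX hX (rfl : a' + 2 * n = a' + 2 * n) u' =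
      corrAction μ hX hX (rfl : a' + 2 * n = a' + 2 * n) u ∘ₗ (if a' = a then LinearMap.id else 0) := fun a' ↦ by
    rw [hact (a := a') (a₁ := a') (a₂ := a') rfl rfl rfl, hπa a']
  have hu'0 : u' = 0 := by
    refine hD u' hu' (cupProduct_eq_zero_of_forall_trace_comp_algebraic_eq_zero μ hX fun w hw a' _ ↦ ?_)
    rw [hact' a']
    split_ifs with haa
    · subst haa
      rw [LinearMap.comp_id]
      exact h w hw
    · rw [LinearMap.comp_zero, LinearMap.comp_zero, map_zero]
  have hfin := hact' a
  rw [hu'0, map_zero, if_pos rfl, LinearMap.comp_id] at hfin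
  exact hfin.symm

/-- **Nil ⟹ zero per degree, modulo `hD` and `hπ`**: if `[w]_* ∘ [u]_*` is nilpotent on `Hᵃ(X(ℂ))` for every algebraic
`w`, then `[u]_* = 0` on `Hᵃ` (`u` algebraic). [cite: Jannsen1992, Lemma 1] [cite: Kleiman1968AlgebraicCycles, §3 Prop. 3.5] -/
theorem corrAction_eq_zero_of_forall_isNilpotent_comp_algebraic (hX : IsSmoothProjective n X)
    (hD : ∀ ξ ∈ algebraicClasses (X ⊗ X) n,
      (∀ v ∈ algebraicClasses (X ⊗ X) n, cupProduct (show 2 * n + 2 * n = 2 * (n + n) by omega) ξ v = 0) → ξ = 0)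
    {a : ℕ} (hπ : ∃ π ∈ algebraicClasses (X ⊗ X) n, ∀ a' : ℕ,
      corrAction μ hX hX (rfl : a' + 2 * n = a' + 2 * n) π = if a' = a then LinearMap.id else 0)
    {u : complexBetti (X ⊗ X) (2 * n)} (hu : u ∈ algebraicClasses (X ⊗ X) n)
    (h : ∀ w ∈ algebraicClasses (X ⊗ X) n,
      IsNilpotent (corrAction μ hX hX (rfl : a + 2 * n = a + 2 * n) w ∘ₗ
        corrAction μ hX hX (rfl : a + 2 * n = a + 2 * n) u)) :
    corrAction μ hX hX (rfl : a + 2 * n = a + 2 * n) u = 0 :=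
  corrAction_eq_zero_of_forall_trace_comp_algebraic_eq_zero μ hX hD hπ hu fun w hw ↦
    (LinearMap.isNilpotent_trace_of_isNilpotent (h w hw)).eq_zero

/-! ## §3 Kleiman / Jannsen: under `B(X, η)` the algebra of algebraic correspondence operators on `Hᵃ` is semisimple -/

/-- **The image of `Aⁿ(X ⊗ X)_ℂ` in `End_ℂ Hᵃ(X(ℂ); ℂ)` is a unital subalgebra** (it contains `1 = [Δ]_*` and is closed
under composition, `exists_corrCompClass_total` with Voisin II Prop. 9.20): the subalgebra it generates equals it as a
set. [cite: Fulton1998, §16.1 Prop. 16.1.1] [cite: VoisinHodgeII2003, §9.2.4 Prop. 9.20] -/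
theorem adjoin_algebraicOperators_eq (hX : IsSmoothProjective n X) (a : ℕ) :
    (Algebra.adjoin ℂ ((algebraicClasses (X ⊗ X) n).map
        (corrAction μ hX hX (rfl : a + 2 * n = a + 2 * n)) : Set (Module.End ℂ (complexBetti X a))) :
        Set (Module.End ℂ (complexBetti X a))) =
      (algebraicClasses (X ⊗ X) n).map (corrAction μ hX hX (rfl : a + 2 * n = a + 2 * n)) := by
  set M := (algebraicClasses (X ⊗ X) n).map (corrAction μ hX hX (rfl : a + 2 * n = a + 2 * n)) with hM
  have hone : (1 : Module.End ℂ (complexBetti X a)) ∈ M := by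
    refine ⟨_, (corrAction_diagonalClass μ hX 0).1, ?_⟩
    rw [(corrAction_diagonalClass μ hX a).2, Module.End.one_eq_id]
  have hmul : ∀ S ∈ M, ∀ T ∈ M, S * T ∈ M := by
    rintro S ⟨γ, hγ, rfl⟩ T ⟨γ', hγ', rfl⟩
    obtain ⟨γ'', -, halg, hact⟩ := exists_corrCompClass_total μ hX hX hX (e := n) (e' := n) (e'' := n) rfl γ γ'
    refine ⟨γ'', halg hγ hγ', ?_⟩
    rw [Module.End.mul_eq_comp, hact (a := a) (a₁ := a) (a₂ := a) rfl rfl rfl]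
  let B : Subalgebra ℂ (Module.End ℂ (complexBetti X a)) :=
    { carrier := M
      mul_mem' := fun hS hT ↦ hmul _ hS _ hT
      one_mem' := hone
      add_mem' := fun hS hT ↦ M.add_mem hS hT
      zero_mem' := M.zero_mem
      algebraMap_mem' := fun c ↦ by
        rw [Algebra.algebraMap_eq_smul_one]
        exact M.smul_mem c hone }
  have hadj : Algebra.adjoin ℂ (M : Set (Module.End ℂ (complexBetti X a))) = B :=
    le_antisymm (Algebra.adjoin_le fun x hx ↦ hx) fun x hx ↦ Algebra.subset_adjoin hx
  rw [hadj]
  rfl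

/-- **Jannsen / Kleiman, modulo `hD` and `hπ`: the operator algebra of `Aⁿ(X ⊗ X)_ℂ` on `Hᵃ(X(ℂ); ℂ)` is semisimple**
(finite-dimensional ⟹ Artinian; its nilpotent Jacobson radical is killed by §2). [cite: Jannsen1992, Thm. 1 and Lemma 1–2]
[cite: Kleiman1968AlgebraicCycles, §3 Thm. 3.11] -/
theorem isSemisimpleRing_adjoin_algebraicOperators_of (hX : IsSmoothProjective n X)
    (hD : ∀ ξ ∈ algebraicClasses (X ⊗ X) n,
      (∀ v ∈ algebraicClasses (X ⊗ X) n, cupProduct (show 2 * n + 2 * n = 2 * (n + n) by omega) ξ v = 0) → ξ = 0)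
    {a : ℕ} (hπ : ∃ π ∈ algebraicClasses (X ⊗ X) n, ∀ a' : ℕ,
      corrAction μ hX hX (rfl : a' + 2 * n = a' + 2 * n) π = if a' = a then LinearMap.id else 0) :
    IsSemisimpleRing (Algebra.adjoin ℂ ((algebraicClasses (X ⊗ X) n).map
      (corrAction μ hX hX (rfl : a + 2 * n = a + 2 * n)) : Set (Module.End ℂ (complexBetti X a)))) := by
  set M := (algebraicClasses (X ⊗ X) n).map (corrAction μ hX hX (rfl : a + 2 * n = a + 2 * n)) with hM
  set B := Algebra.adjoin ℂ (M : Set (Module.End ℂ (complexBetti X a))) with hB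
  have hBM : ∀ x : Module.End ℂ (complexBetti X a), x ∈ B ↔ x ∈ M := fun x ↦ by
    rw [← SetLike.mem_coe, hB, hM, adjoin_algebraicOperators_eq μ hX a, SetLike.mem_coe]
  haveI : Module.Finite ℂ (complexBetti X a) := finite_complexBetti hX a
  haveI : IsArtinianRing B := IsArtinianRing.of_finite ℂ B
  rw [IsArtinianRing.isSemisimpleRing_iff_jacobson]
  refine eq_bot_iff.mpr fun x hx ↦ ?_
  obtain ⟨k, hk⟩ := IsSemiprimaryRing.isNilpotent (R := B)
  have hnil : ∀ y : B, IsNilpotent ((y : Module.End ℂ (complexBetti X a)) * x) := fun y ↦ by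
    have hyx := Ideal.pow_mem_pow (Ideal.mul_mem_left _ y hx) k
    rw [hk, Ideal.zero_eq_bot, Ideal.mem_bot] at hyx
    exact ⟨k, by rw [← Subalgebra.coe_mul, ← Subalgebra.coe_pow, hyx, Subalgebra.coe_zero]⟩
  obtain ⟨u, hu, hux⟩ := (hBM x).mp x.2
  have hx0 : (x : Module.End ℂ (complexBetti X a)) = 0 := by
    rw [← hux]
    refine corrAction_eq_zero_of_forall_isNilpotent_comp_algebraic μ hX hD hπ hu fun w hw ↦ ?_
    rw [hux, ← Module.End.mul_eq_comp]
    exact hnil ⟨_, (hBM _).mpr ⟨w, hw, rfl⟩⟩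
  rw [Ideal.mem_bot]
  exact Subtype.ext hx0

/-- **KLEIMAN 1968 / JANNSEN 1992 on the real carriers: `B(X, η) ⟹` the `ℂ`-algebra of operators on `Hᵃ(X(ℂ); ℂ)`
induced by the algebraic classes `Aⁿ(X ⊗ X)_ℂ` is SEMISIMPLE** (complex orientation family, every degree `a`). For a
polarisation class `η` with `StandardConjectureBStar n X η`: `B(X ⊗ X, θ)` for every `θ` (`standardConjectureBStar_tensor`),
hence `A(X ⊗ X, θ)` for every polarisation class `θ` (`standardConjectureA_of_standardConjectureBStar`), hence hom ≡ num on
`Aⁿ(X ⊗ X)_ℂ` over `ℂ` (`nondegenerate_algebraicClasses_of_standardConjectureA`, Hodge–Riemann); and `C(X)`: algebraic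
Künneth projectors (`exists_algebraic_kunnethProjector_of_standardConjectureBStar`). Conclude by
`isSemisimpleRing_adjoin_algebraicOperators_of`. `B(X, η)` is a HYPOTHESIS (open); nothing is asserted.
[cite: Kleiman1968AlgebraicCycles, §3 Thm. 3.11 and Cor. 2.5] [cite: Jannsen1992, Thm. 1] [cite: Grothendieck1968, §3 p. 196] -/
theorem isSemisimpleRing_adjoin_algebraicOperators_of_standardConjectureBStar (hX : IsSmoothProjective n X)
    {η : complexBetti X 2} (hη : IsPolarizationClass n X η) (hB : StandardConjectureBStar n X η) (a : ℕ) :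
    IsSemisimpleRing (Algebra.adjoin ℂ ((algebraicClasses (X ⊗ X) n).map
      (corrAction complexOrientationFamily hX hX (rfl : a + 2 * n = a + 2 * n)) :
        Set (Module.End ℂ (complexBetti X a)))) := by
  have hXX : IsSmoothProjective (n + n) (X ⊗ X) := IsSmoothProjective.tensor_holds hX hX
  have hA : ∀ θ : complexBetti (X ⊗ X) 2, IsPolarizationClass (n + n) (X ⊗ X) θ → StandardConjectureA (n + n) (X ⊗ X) θ :=
    fun θ hθ ↦ Ring2.AbelianAll.standardConjectureA_of_standardConjectureBStar hXX hθ
      (Ring2.AbelianAll.standardConjectureBStar_tensor hX hX hη hB hη hB θ)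
  exact isSemisimpleRing_adjoin_algebraicOperators_of complexOrientationFamily hX
    (Ring2.AbelianAll.nondegenerate_algebraicClasses_of_standardConjectureA hXX hA (p := n) (q := n) rfl).1
    (exists_algebraic_kunnethProjector_of_standardConjectureBStar hX hη hB a)

/-- **Under `B(X, η)`: `Hᵃ(X(ℂ); ℂ)` is a semisimple module over the algebra of algebraic correspondence operators.**
[cite: Jannsen1992, Thm. 1] [cite: Kleiman1968AlgebraicCycles, §3 Thm. 3.11] -/
theorem isSemisimpleModule_algebraicOperators_of_standardConjectureBStar (hX : IsSmoothProjective n X)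
    {η : complexBetti X 2} (hη : IsPolarizationClass n X η) (hB : StandardConjectureBStar n X η) (a : ℕ) :
    IsSemisimpleModule (Algebra.adjoin ℂ ((algebraicClasses (X ⊗ X) n).map
      (corrAction complexOrientationFamily hX hX (rfl : a + 2 * n = a + 2 * n)) :
        Set (Module.End ℂ (complexBetti X a)))) (complexBetti X a) := by
  haveI := isSemisimpleRing_adjoin_algebraicOperators_of_standardConjectureBStar hX hη hB a
  infer_instance

/-- **Under `B(X, η)`: complete reducibility of `Hᵃ(X(ℂ); ℂ)` under algebraic correspondences** — every `ℂ`-subspace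
`W ⊆ Hᵃ(X(ℂ); ℂ)` stable under `[u]_*` for all algebraic `u ∈ Aⁿ(X ⊗ X)_ℂ` (complex orientation family) has a
complement stable under all of them. [cite: Jannsen1992, Thm. 1] [cite: Kleiman1968AlgebraicCycles, §3 Thm. 3.11] -/
theorem exists_isCompl_of_algebraicOperators_stable_of_standardConjectureBStar (hX : IsSmoothProjective n X)
    {η : complexBetti X 2} (hη : IsPolarizationClass n X η) (hB : StandardConjectureBStar n X η) (a : ℕ)
    {W : Submodule ℂ (complexBetti X a)}
    (hW : ∀ u ∈ algebraicClasses (X ⊗ X) n, ∀ v ∈ W,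
      corrAction complexOrientationFamily hX hX (rfl : a + 2 * n = a + 2 * n) u v ∈ W) :
    ∃ W' : Submodule ℂ (complexBetti X a), IsCompl W W' ∧
      ∀ u ∈ algebraicClasses (X ⊗ X) n, ∀ v ∈ W',
        corrAction complexOrientationFamily hX hX (rfl : a + 2 * n = a + 2 * n) u v ∈ W' := by
  set M := (algebraicClasses (X ⊗ X) n).map
    (corrAction complexOrientationFamily hX hX (rfl : a + 2 * n = a + 2 * n)) with hM
  set B := Algebra.adjoin ℂ (M : Set (Module.End ℂ (complexBetti X a))) with hB'
  have hBM : ∀ x : Module.End ℂ (complexBetti X a), x ∈ B ↔ x ∈ M := fun x ↦ by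
    rw [← SetLike.mem_coe, hB', hM, adjoin_algebraicOperators_eq complexOrientationFamily hX a, SetLike.mem_coe]
  haveI := isSemisimpleModule_algebraicOperators_of_standardConjectureBStar hX hη hB a
  have hWB : ∀ (T : B) (v : complexBetti X a), v ∈ W → (T : Module.End ℂ (complexBetti X a)) v ∈ W := by
    rintro ⟨T, hT⟩ v hv
    obtain ⟨u, hu, rfl⟩ := (hBM T).mp hT
    exact hW u hu v hv
  let WB : Submodule B (complexBetti X a) :=
    { carrier := W
      add_mem' := fun hv hw ↦ W.add_mem hv hw
      zero_mem' := W.zero_mem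
      smul_mem' := fun T v hv ↦ hWB T v hv }
  obtain ⟨WB', hcompl⟩ := exists_isCompl WB
  let W' : Submodule ℂ (complexBetti X a) :=
    { carrier := WB'
      add_mem' := fun hv hw ↦ WB'.add_mem hv hw
      zero_mem' := WB'.zero_mem
      smul_mem' := fun c v hv ↦ by
        have h := WB'.smul_mem (algebraMap ℂ B c) hv
        have e : (algebraMap ℂ B c) • v = c • v := by
          change ((algebraMap ℂ B c : B) : Module.End ℂ (complexBetti X a)) v = c • v
          rw [Subalgebra.coe_algebraMap, Module.algebraMap_end_apply]
        rwa [e] at h }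
  refine ⟨W', ⟨?_, ?_⟩, fun u hu v hv ↦ ?_⟩
  · rw [Submodule.disjoint_def]
    intro v hv hv'
    exact (Submodule.disjoint_def.mp hcompl.disjoint) v hv hv'
  · rw [codisjoint_iff_le_sup]
    intro v _
    have h : v ∈ WB ⊔ WB' := hcompl.codisjoint.top_le (Submodule.mem_top : v ∈ (⊤ : Submodule B _))
    obtain ⟨y, hy, z, hz, rfl⟩ := Submodule.mem_sup.mp h
    exact Submodule.mem_sup.mpr ⟨y, hy, z, hz, rfl⟩
  · have hT : corrAction complexOrientationFamily hX hX (rfl : a + 2 * n = a + 2 * n) u ∈ B :=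
      (hBM _).mpr ⟨u, hu, rfl⟩
    exact WB'.smul_mem (⟨_, hT⟩ : B) hv

end Summit.HodgeConjecture.HodgeConjecture.Theorems

end
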